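import Summits.ValiantsHypothesis.ValiantsHypothesis.Theorems.LacunarySymmetroidMatrixDescartesDoorA26WallBubblingWeylTripleSlots

/-!
# Wall bubbling for `DoorA26` — THE STRATUM [3,2,1]: THE SLOT COUNT OF THE CLUSTER LIMIT UNDER THE RIGIDITY DICHOTOMY (`≤ 19` zeros with multiplicity)

HONEST FRAMING.  Chain lemma toward `TripleStratum26` of `Cruxes/DoorA26/Lines/wall_bubbling_ConfluentDoor.lean` (rev 13; crux `DoorA26`,
stmt-ValiantsHypothesis-19979 — OPEN, typed, never asserted).  W1 seat val-sym-door-p2 g15 (#107); the [3,2,1] clone of #86 / #96 / #103.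
BOOKKEEPING ONLY (def-free).  The function-level limit of a single cluster at the stratum [3,2,1] (values `e : Fin 3 → ℝ` 2-Sidon; value `0` the
pair's, `1` the single's, `2` the triple's) is `g(s) = Σ_{k ∈ Fin 3 × Fin 3} Q_k(s)·e^{(e k₁ + e k₂)s}` with ORDERED classes and slot numbers
`n = ![![3,2,6],![2,1,3],![6,3,6]]` (`2+2`: 6, `0+2`: 6, `1+2`: 3, `0+0`: 3, `0+1`: 2, `1+1`: 1; total `21` unordered), symmetric coefficients.

* **`weyl321_zerosWithMultiplicity_le`** — under the RIGIDITY DICHOTOMY «`c_{(2,2),5} = 0` OR `c_{(1,1),0} = 0`» (the triple's sixth slot or the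
  single's pure class dies — #88 `weylTriple_dichotomy` with both outside letters equal to the single) and one non-zero coefficient, `g` has at most
  `19` real zeros counted with multiplicity (slots `5+6+3+3+2+1 = 20` resp. `6+6+3+3+2+0 = 20`; W1 #12 `extSum_zerosWithMultiplicity_le`) — NO door.

Nothing here bears on `DoorA26`, `MatrixDescartes` (stmt-ValiantsHypothesis-18050) or `VP ≠ VNP`; `TripleStratum26`, (W), (M) OPEN.
`--supports stmt-ValiantsHypothesis-19979 --as helper`.  [folklore] Laguerre–Pólya slot count.  [this work] the [3,2,1] slot table.
-/

-- `Summit.ValiantsHypothesis.ValiantsHypothesis.…` repeats a component by the D-0017 layout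
-- (single-conjunct summit), which the `dupNamespace` linter flags; the name is mandated.
set_option linter.dupNamespace false

namespace Summit.ValiantsHypothesis.ValiantsHypothesis.Theorems.LacunarySymmetroidMatrixDescartes.WallBubbling

open Finset Polynomial
open Literature.Analysis.TotalPositivity.LaguerreRuleOfSigns (ZerosWithMultiplicityLE)
open scoped BigOperators

/-! ## The slot count at the stratum [3,2,1] -/

/-- **THE SLOT COUNT OF THE [3,2,1] CLUSTER LIMIT.**  Values `e : Fin 3 → ℝ` 2-Sidon, ordered classes `k : Fin 3 × Fin 3` with slot numbers
`![![3,2,6],![2,1,3],![6,3,6]]`, symmetric coefficients, one non-zero coefficient, and the RIGIDITY DICHOTOMY ⇒ at most `19` zeros with multiplicity.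
[this work] -/
theorem weyl321_zerosWithMultiplicity_le (e : Fin 3 → ℝ)
    (hvg : ∀ a b c d : Fin 3, e a + e b = e c + e d → (a = c ∧ b = d) ∨ (a = d ∧ b = c))
    (c : Fin 3 × Fin 3 → ℕ → ℝ) (hsymm : ∀ k m, c k.swap m = c k m)
    (hne : ∃ k m, m < (fun k : Fin 3 × Fin 3 => (![![3, 2, 6], ![2, 1, 3], ![6, 3, 6]] : Fin 3 → Fin 3 → ℕ) k.1 k.2) k ∧ c k m ≠ 0)
    (hdich : c (2, 2) 5 = 0 ∨ c (1, 1) 0 = 0) :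
    ZerosWithMultiplicityLE
      (fun s => ∑ k : Fin 3 × Fin 3,
        (∑ m ∈ Finset.range ((fun k : Fin 3 × Fin 3 => (![![3, 2, 6], ![2, 1, 3], ![6, 3, 6]] : Fin 3 → Fin 3 → ℕ) k.1 k.2) k),
          c k m * s ^ m / (m.factorial : ℝ)) * Real.exp ((e k.1 + e k.2) * s))
      Set.univ 19 := by
  classical
  -- slot numbers, class polynomials, values
  set n : Fin 3 × Fin 3 → ℕ := fun k => (![![3, 2, 6], ![2, 1, 3], ![6, 3, 6]] : Fin 3 → Fin 3 → ℕ) k.1 k.2 with hn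
  set Q : Fin 3 × Fin 3 → ℝ[X] := fun k => ∑ m ∈ Finset.range (n k), C (c k m / (m.factorial : ℝ)) * X ^ m with hQ
  set w : Fin 3 × Fin 3 → ℝ := fun k => e k.1 + e k.2 with hw
  set F : Finset ℝ := (univ : Finset (Fin 3 × Fin 3)).image w with hFdef
  set P : ℝ → ℝ[X] := fun v => ∑ k, if w k = v then Q k else 0 with hP
  have hF : ∀ k, w k ∈ F := fun k => Finset.mem_image.mpr ⟨k, Finset.mem_univ _, rfl⟩
  have h3 : ∀ z : Fin 3, z = 0 ∨ z = 1 ∨ z = 2 := by decide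
  -- the slot table, evaluated
  have hn00 : n (0, 0) = 3 := by simp [hn]
  have hn01 : n (0, 1) = 2 := by simp [hn]
  have hn02 : n (0, 2) = 6 := by simp [hn]
  have hn10 : n (1, 0) = 2 := by simp [hn]
  have hn11 : n (1, 1) = 1 := by simp [hn]
  have hn12 : n (1, 2) = 3 := by simp [hn]
  have hn20 : n (2, 0) = 6 := by simp [hn]
  have hn21 : n (2, 1) = 3 := by simp [hn]
  have hn22 : n (2, 2) = 6 := by simp [hn]
  -- the function is the extended sum over `F`
  have hfun : (fun s => ∑ k : Fin 3 × Fin 3, (∑ m ∈ Finset.range (n k), c k m * s ^ m / (m.factorial : ℝ)) * Real.exp ((e k.1 + e k.2) * s))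
      = fun s => ∑ v ∈ F, (P v).eval s * Real.exp (v * s) := by
    funext s
    rw [← weylTriple_limit_extSum w Q F hF s]
    refine Finset.sum_congr rfl fun k _ => ?_
    rw [hQ, eval_classPoly]
  rw [hfun]
  -- fibres by 2-Sidon-ness: `w k = w k'` iff `k' ∈ {k, k.swap}`
  have hfib : ∀ k k' : Fin 3 × Fin 3, w k' = w k → k' = k ∨ k' = k.swap := by
    intro k k' h
    rcases hvg k'.1 k'.2 k.1 k.2 h with ⟨h1, h2⟩ | ⟨h1, h2⟩
    · left; exact Prod.ext h1 h2
    · right; exact Prod.ext h1 h2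
  have hn_swap : ∀ k : Fin 3 × Fin 3, n k.swap = n k := by
    rintro ⟨k1, k2⟩
    rcases h3 k1 with rfl | rfl | rfl <;> rcases h3 k2 with rfl | rfl | rfl <;> simp [hn]
  -- degree bound of `P v` by the slot number of any class in its fibre
  have hdegP : ∀ k : Fin 3 × Fin 3, ∀ d : ℕ, (Q k).natDegree ≤ d → (Q k.swap).natDegree ≤ d → (P (w k)).natDegree ≤ d := by
    intro k d hk hks
    refine natDegree_sum_le_of_forall_le _ _ fun k' _ => ?_
    by_cases h : w k' = w k
    · rw [if_pos h]
      rcases hfib k k' h with rfl | rfl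
      · exact hk
      · exact hks
    · rw [if_neg h, natDegree_zero]; exact Nat.zero_le _
  have hdegQ : ∀ k, (Q k).natDegree ≤ n k - 1 := fun k => natDegree_classPoly_le (c k) (n k)
  have hdegQs : ∀ k, (Q k.swap).natDegree ≤ n k - 1 := fun k => by have := hdegQ k.swap; rwa [hn_swap] at this
  -- some `P v` is non-zero
  have hPne : ∃ v ∈ F, P v ≠ 0 := by
    obtain ⟨k₀, m₀, hm₀, hc₀⟩ := hne
    refine ⟨w k₀, hF k₀, fun h0 => hc₀ ?_⟩
    have hcoeff : (P (w k₀)).coeff m₀ = 0 := by rw [h0, coeff_zero]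
    rw [hP] at hcoeff
    simp only at hcoeff
    rw [finsetSum_coeff] at hcoeff
    have hterm : ∀ k' : Fin 3 × Fin 3, (if w k' = w k₀ then Q k' else 0).coeff m₀
        = if k' = k₀ ∨ k' = k₀.swap then c k₀ m₀ / (m₀.factorial : ℝ) else 0 := by
      intro k'
      by_cases h : w k' = w k₀
      · rw [if_pos h, if_pos (hfib k₀ k' h)]
        rcases hfib k₀ k' h with rfl | rfl
        · exact coeff_classPoly _ _ _ hm₀
        · rw [hQ]; simp only
          rw [hn_swap, coeff_classPoly _ _ _ hm₀, hsymm]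
      · have h' : ¬ (k' = k₀ ∨ k' = k₀.swap) := by
          rintro (rfl | rfl)
          · exact h rfl
          · exact h (by simp only [hw, Prod.fst_swap, Prod.snd_swap]; ring)
        rw [if_neg h, if_neg h', coeff_zero]
    simp only [hterm] at hcoeff
    rw [Finset.sum_ite, Finset.sum_const_zero, add_zero, Finset.sum_const, nsmul_eq_mul] at hcoeff
    have hcard : 0 < (Finset.univ.filter fun k' : Fin 3 × Fin 3 => k' = k₀ ∨ k' = k₀.swap).card :=
      Finset.card_pos.mpr ⟨k₀, Finset.mem_filter.mpr ⟨Finset.mem_univ _, Or.inl rfl⟩⟩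
    have hm0 : (m₀.factorial : ℝ) ≠ 0 := by positivity
    rcases mul_eq_zero.mp hcoeff with h | h
    · exact absurd h (ne_of_gt (by exact_mod_cast hcard))
    · rcases div_eq_zero_iff.mp h with h | h
      · exact h
      · exact absurd h hm0
  -- the six values
  have hcover : F ⊆ {w (2, 2)} ∪ {w (0, 2)} ∪ {w (1, 2)} ∪ {w (0, 0)} ∪ {w (0, 1)} ∪ {w (1, 1)} := by
    intro v hv
    obtain ⟨k, -, rfl⟩ := Finset.mem_image.mp hv
    obtain ⟨k1, k2⟩ := k
    simp only [Finset.mem_union, Finset.mem_singleton]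
    rcases h3 k1 with rfl | rfl | rfl <;> rcases h3 k2 with rfl | rfl | rfl
    · exact Or.inl (Or.inl (Or.inr rfl))
    · exact Or.inl (Or.inr rfl)
    · exact Or.inl (Or.inl (Or.inl (Or.inl (Or.inr rfl))))
    · exact Or.inl (Or.inr (by simp only [hw]; ring))
    · exact Or.inr rfl
    · exact Or.inl (Or.inl (Or.inl (Or.inr rfl)))
    · exact Or.inl (Or.inl (Or.inl (Or.inl (Or.inr (by simp only [hw]; ring)))))
    · exact Or.inl (Or.inl (Or.inl (Or.inr (by simp only [hw]; ring))))
    · exact Or.inl (Or.inl (Or.inl (Or.inl (Or.inl rfl))))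
  -- slot function and its bounds on the six pieces
  set slot : ℝ → ℕ := fun v => if P v = 0 then 0 else (P v).natDegree + 1 with hslot
  have hslot_le : ∀ k : Fin 3 × Fin 3, slot (w k) ≤ n k := by
    intro k
    simp only [hslot]
    split_ifs with hP0
    · exact Nat.zero_le _
    · have hk : 0 < n k := by
        obtain ⟨k1, k2⟩ := k
        rcases h3 k1 with rfl | rfl | rfl <;> rcases h3 k2 with rfl | rfl | rfl <;> simp [hn]
      have := hdegP k (n k - 1) (hdegQ k) (hdegQs k)
      omega
  have hslot22 : slot (w (2, 2)) ≤ (if c (2, 2) 5 = 0 then 5 else 6) := by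
    split_ifs with h5
    · simp only [hslot]
      split_ifs with hP0
      · exact Nat.zero_le _
      · have hq : (Q (2, 2)).natDegree ≤ 4 := by
          have := natDegree_classPoly_le_of_top_eq_zero (c (2, 2)) 6 (by norm_num) (by simpa using h5)
          simpa [hQ, hn22] using this
        have := hdegP (2, 2) 4 hq (by simpa using hq)
        omega
    · have := hslot_le (2, 2); rwa [hn22] at this
  have hslot11 : slot (w (1, 1)) ≤ (if c (2, 2) 5 = 0 then 1 else 0) := by
    split_ifs with h5
    · have := hslot_le (1, 1); rwa [hn11] at this
    · have hpure : c (1, 1) 0 = 0 := hdich.resolve_left h5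
      have hP0 : P (w (1, 1)) = 0 := by
        rw [hP]; simp only
        refine Finset.sum_eq_zero fun k' _ => ?_
        by_cases h : w k' = w (1, 1)
        · rw [if_pos h]
          have hQ0 : Q (1, 1) = 0 := by
            rw [hQ]; simp only
            rw [hn11, Finset.sum_range_one, hpure, zero_div, map_zero, zero_mul]
          rcases hfib _ k' h with rfl | rfl
          · exact hQ0
          · exact hQ0
        · rw [if_neg h]
      simp only [hslot]
      rw [if_pos hP0]
  have hslot02 : slot (w (0, 2)) ≤ 6 := by have := hslot_le (0, 2); rwa [hn02] at this
  have hslot12 : slot (w (1, 2)) ≤ 3 := by have := hslot_le (1, 2); rwa [hn12] at this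
  have hslot00 : slot (w (0, 0)) ≤ 3 := by have := hslot_le (0, 0); rwa [hn00] at this
  have hslot01 : slot (w (0, 1)) ≤ 2 := by have := hslot_le (0, 1); rwa [hn01] at this
  -- sum over `F`
  have hslot_nonneg : ∀ v, 0 ≤ slot v := fun v => Nat.zero_le _
  have hul : ∀ s t : Finset ℝ, ∑ v ∈ s ∪ t, slot v ≤ ∑ v ∈ s, slot v + ∑ v ∈ t, slot v := by
    intro s t; rw [← Finset.sum_union_inter]; exact Nat.le_add_right _ _
  have hsumF : ∑ v ∈ F, slot v ≤ slot (w (2, 2)) + slot (w (0, 2)) + slot (w (1, 2)) + slot (w (0, 0)) + slot (w (0, 1)) + slot (w (1, 1)) := by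
    calc ∑ v ∈ F, slot v ≤ ∑ v ∈ {w (2, 2)} ∪ {w (0, 2)} ∪ {w (1, 2)} ∪ {w (0, 0)} ∪ {w (0, 1)} ∪ {w (1, 1)}, slot v :=
          Finset.sum_le_sum_of_subset_of_nonneg hcover fun v _ _ => hslot_nonneg v
      _ ≤ ∑ v ∈ {w (2, 2)} ∪ {w (0, 2)} ∪ {w (1, 2)} ∪ {w (0, 0)} ∪ {w (0, 1)}, slot v + ∑ v ∈ {w (1, 1)}, slot v := hul _ _
      _ ≤ ∑ v ∈ {w (2, 2)} ∪ {w (0, 2)} ∪ {w (1, 2)} ∪ {w (0, 0)}, slot v + ∑ v ∈ {w (0, 1)}, slot v + ∑ v ∈ {w (1, 1)}, slot v :=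
          Nat.add_le_add_right (hul _ _) _
      _ ≤ ∑ v ∈ {w (2, 2)} ∪ {w (0, 2)} ∪ {w (1, 2)}, slot v + ∑ v ∈ {w (0, 0)}, slot v + ∑ v ∈ {w (0, 1)}, slot v
            + ∑ v ∈ {w (1, 1)}, slot v := Nat.add_le_add_right (Nat.add_le_add_right (hul _ _) _) _
      _ ≤ ∑ v ∈ {w (2, 2)} ∪ {w (0, 2)}, slot v + ∑ v ∈ {w (1, 2)}, slot v + ∑ v ∈ {w (0, 0)}, slot v + ∑ v ∈ {w (0, 1)}, slot v
            + ∑ v ∈ {w (1, 1)}, slot v := Nat.add_le_add_right (Nat.add_le_add_right (Nat.add_le_add_right (hul _ _) _) _) _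
      _ ≤ ∑ v ∈ {w (2, 2)}, slot v + ∑ v ∈ {w (0, 2)}, slot v + ∑ v ∈ {w (1, 2)}, slot v + ∑ v ∈ {w (0, 0)}, slot v
            + ∑ v ∈ {w (0, 1)}, slot v + ∑ v ∈ {w (1, 1)}, slot v :=
          Nat.add_le_add_right (Nat.add_le_add_right (Nat.add_le_add_right (Nat.add_le_add_right (hul _ _) _) _) _) _
      _ = slot (w (2, 2)) + slot (w (0, 2)) + slot (w (1, 2)) + slot (w (0, 0)) + slot (w (0, 1)) + slot (w (1, 1)) := by
          simp only [Finset.sum_singleton]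
  have hslots : ∑ v ∈ F, slot v ≤ 19 + 1 := by
    have h := hsumF
    split_ifs at hslot22 hslot11 with h5 <;> omega
  exact Bubbling.extSum_zerosWithMultiplicity_le 19 F P hPne (by simpa [hslot] using hslots)

end Summit.ValiantsHypothesis.ValiantsHypothesis.Theorems.LacunarySymmetroidMatrixDescartes.WallBubbling
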